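import Summits.Ventures.CertifiedManyBodySolver.Downfold.EmeryChargeTransferSlope
import Summits.Ventures.CertifiedManyBodySolver.Downfold.EmeryChargeTransferLipschitz
import HarnessLib

/-!
# THE FERMI-ENERGY SLOPE LAW: `ε_AB(Δ + δ; k) ≤ ε_AB(Δ; k) − κδ` for EVERY `δ ≥ 0` once `κ < 1 −` (a bound of the Cu-d weight along the way), by telescoping the one-step law;
# and its transfer to the Fermi energy at fixed filling (INFL-3to1-B §B.90 (i); the missing half of `EmeryChargeTransferLipschitz`'s `−1 ≤ slope ≤ 0`)

Venture CertifiedManyBodySolver, cell `pub/hubbard-downfold` (stage S1; INFLATION-RULES-3to1-B §B.83, §B.90 (h)–(i)), seat hubbard-downfold-mod-4 (technique B, g38); namespace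
`Summit.Ventures.CertifiedManyBodySolver.Downfold.Emery`. Sequel of `EmeryChargeTransferSlope` (one step: `δ(E′ + δ) ≤ 2(1 − κ − w̄)E′² ⇒ ε_AB(Δ + δ) ≤ ε_AB(Δ) − κδ`).
Everything PROVED (0 sorry; telescoping over `n` equal steps chosen by the Archimedean property — the smallness condition of the one-step law is per step, the rate `κ`
is not).  WHAT THIS IS NOT: a statement about any material; `U = 0` one-body kinematics of the σ model.

* §1 **POINTWISE SLOPE LAW** `abBand_slope_law`: `Δ > 0`, `a ≠ 0`, `0 ≤ t_pp′ ≤ t_pp`, `k ∈ [0, 1]²`, `δ ≥ 0`, `κ ≥ 0`; if the Cu-d weight of the state `k` at its band energy stays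
  `≤ w̄` along `[Δ, Δ + δ]` and `κ + w̄ < 1`, and `ε_AB(Δ + δ; k) > 0`, then **`ε_AB(Δ + δ; k) + κδ ≤ ε_AB(Δ; k)`** — the band falls at rate at least its oxygen weight.
* §2 **TRANSFER TO THE FERMI ENERGY** (one Δ-step): if every state in the energy shell `(ε_F − κδ, ε_F]` of row `Δ` obeys the pointwise law, then
  `abFilling(Δ + δ; ε_F − κδ) ≥ ν` and **`ε_F(Δ + δ; ν) ≤ ε_F(Δ; ν) − κδ`** (`fermiEnergyOf_shift_le_sub_of_shell`).
* §3 (sequel / successor): telescoping §2 over small Δ-steps with `w̄` = the axis ceiling at the box's bottom energy gives the box-level law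
  `ε_F(Δ₂-corner) ≤ ε_F(Δ₁-corner) − κ(Δ₂ − Δ₁)` for every `κ < 1 − ceiling` — the energy channel of the FIXED-FILLING antinodal lever.

Sources: three-band model [HybertsenSchluterChristensen1989, Eq. (1)]; Hellmann–Feynman / first-order perturbation theory [folklore]; [folklore] analysis.
-/

noncomputable section

namespace Summit.Ventures.CertifiedManyBodySolver.Downfold.Emery

open Real Set MeasureTheory

/-! ## §1 The pointwise slope law for finite `δ` -/

/-- Telescoping engine: with step `h ≥ 0`, if every single step from `Δ + jh` (`j < n`) drops the band by at least `κh`, then `n` steps drop it by at least `κ·n·h`. [folklore] -/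
theorem abBand_steps_le {Δ a b c x y h κ : ℝ} {n : ℕ}
    (hstep : ∀ j : ℕ, j < n → abBand (Δ + (j + 1) * h) a b c x y + κ * h ≤ abBand (Δ + j * h) a b c x y) :
    abBand (Δ + n * h) a b c x y + κ * (n * h) ≤ abBand Δ a b c x y := by
  induction n with
  | zero => simp
  | succ m ih =>
    have h1 := ih (fun j hj => hstep j (Nat.lt_succ_of_lt hj))
    have h2 := hstep m (Nat.lt_succ_self m)
    push_cast at h1 h2 ⊢
    linarith

/-- **THE POINTWISE SLOPE LAW (finite `δ`).** Row `(Δ, a, b, c)` with `Δ > 0`, `a ≠ 0`, `0 ≤ c ≤ b`; zone point `(x, y) ∈ [0, 1]²`; `δ ≥ 0`, `κ ≥ 0`. If the Cu-d weight of the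
antibonding state at `(x, y)` is at most `w̄` for every intermediate row `Δ + t`, `t ∈ [0, δ]` (at its own band energy), if `κ + w̄ < 1`, and if the final band energy
`ε_AB(Δ + δ; x, y)` is positive, then **`ε_AB(Δ + δ; x, y) + κδ ≤ ε_AB(Δ; x, y)`**. [folklore] -/
theorem abBand_slope_law {Δ a b c x y δ κ wbar : ℝ} (hΔ : 0 < Δ) (ha : a ≠ 0) (hc : 0 ≤ c) (hcb : c ≤ b) (hx : x ∈ Icc (0 : ℝ) 1) (hy : y ∈ Icc (0 : ℝ) 1)
    (hδ : 0 ≤ δ) (hκ0 : 0 ≤ κ) (hκ : κ + wbar < 1) (hE : 0 < abBand (Δ + δ) a b c x y)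
    (hW : ∀ t ∈ Icc (0 : ℝ) δ, dWeight (Δ + t) a b c x y (abBand (Δ + t) a b c x y) ≤ wbar) :
    abBand (Δ + δ) a b c x y + κ * δ ≤ abBand Δ a b c x y := by
  have hb : 0 ≤ b := hc.trans hcb
  set Efin := abBand (Δ + δ) a b c x y with hEfin
  set Etop := abBand Δ a b c x y with hEtop
  -- monotonicity in Δ bounds every intermediate band energy by [Efin, Etop]
  have hmono : ∀ {t s : ℝ}, 0 ≤ t → t ≤ s → abBand (Δ + s) a b c x y ≤ abBand (Δ + t) a b c x y := by
    intro t s ht hts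
    have := abBand_shift_le_abBand (Δ := Δ + t) (a := a) (b := b) (c := c) (x := x) (y := y) (δ := s - t) (by linarith) ha hc hb hx.1 hy.1 (by linarith)
    rw [show Δ + t + (s - t) = Δ + s by ring] at this; exact this
  have hEtop_pos : 0 < Etop := by
    have := hmono (t := 0) (s := δ) le_rfl hδ
    rw [add_zero] at this
    exact lt_of_lt_of_le hE this
  have hκ1 : κ ≤ 1 := by
    have hw0 := hW 0 ⟨le_rfl, hδ⟩
    rw [add_zero] at hw0
    have : 0 ≤ wbar := le_trans (dWeight_nonneg hΔ.le hc hb hx.1 hy.1 hEtop_pos) hw0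
    linarith
  -- choose the number of steps: (δ/n)(Etop + δ/n) ≤ 2(1 − κ − w̄)Efin²
  have hR : 0 < 2 * (1 - κ - wbar) * Efin ^ 2 := by have : 0 < 1 - κ - wbar := by linarith
                                                    positivity
  obtain ⟨n, hn⟩ := exists_nat_gt (δ * (Etop + δ) / (2 * (1 - κ - wbar) * Efin ^ 2))
  have hn0 : 0 < (n : ℝ) := lt_of_le_of_lt (div_nonneg (mul_nonneg hδ (by linarith [hEtop_pos])) hR.le) hn
  have hnpos : 0 < n := by exact_mod_cast hn0
  set h := δ / n with hh
  have hh0 : 0 ≤ h := div_nonneg hδ hn0.le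
  have hhδ : h ≤ δ := div_le_self hδ (by exact_mod_cast Nat.one_le_iff_ne_zero.2 (Nat.pos_iff_ne_zero.1 hnpos))
  have hnh : (n : ℝ) * h = δ := by rw [hh]; field_simp
  -- the per-step smallness
  have hsmall : h * (Etop + h) ≤ 2 * (1 - κ - wbar) * Efin ^ 2 := by
    have h1 : δ * (Etop + δ) < n * (2 * (1 - κ - wbar) * Efin ^ 2) := by
      have := (div_lt_iff₀ hR).1 hn; linarith
    have hEtop0 : 0 ≤ Etop := hEtop_pos.le
    have h2 : h * (Etop + h) ≤ h * (Etop + δ) := mul_le_mul_of_nonneg_left (by linarith) hh0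
    have h3 : h * (Etop + δ) = δ * (Etop + δ) / n := by rw [hh]; field_simp
    have h4 : δ * (Etop + δ) / n ≤ 2 * (1 - κ - wbar) * Efin ^ 2 := by
      rw [div_le_iff₀ hn0]; linarith
    linarith
  -- every step
  have hstep : ∀ j : ℕ, j < n → abBand (Δ + (j + 1) * h) a b c x y + κ * h ≤ abBand (Δ + j * h) a b c x y := by
    intro j hj
    have hj1 : ((j : ℝ) + 1) * h ≤ δ := by
      have : ((j : ℝ) + 1) ≤ n := by exact_mod_cast hj
      calc ((j : ℝ) + 1) * h ≤ n * h := mul_le_mul_of_nonneg_right this hh0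
        _ = δ := hnh
    have hj0 : 0 ≤ (j : ℝ) * h := mul_nonneg (Nat.cast_nonneg j) hh0
    have e : Δ + (j + 1) * h = Δ + j * h + h := by ring
    rw [e]
    -- the state after the step: its energy E' ∈ [Efin, Etop], weight ≤ w̄
    have hE'lo : Efin ≤ abBand (Δ + j * h + h) a b c x y := by
      have := hmono (t := (j + 1) * h) (s := δ) (by positivity) hj1
      rw [show Δ + (↑j + 1) * h = Δ + j * h + h by ring] at this; exact this
    have hE'hi : abBand (Δ + j * h + h) a b c x y ≤ Etop := by
      have := hmono (t := 0) (s := (j + 1) * h) le_rfl (by positivity)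
      rw [add_zero, show Δ + (↑j + 1) * h = Δ + j * h + h by ring] at this; exact this
    have hE'pos : 0 < abBand (Δ + j * h + h) a b c x y := lt_of_lt_of_le hE hE'lo
    have hw := hW ((j + 1) * h) ⟨by positivity, hj1⟩
    rw [show Δ + (↑j + 1) * h = Δ + j * h + h by ring] at hw
    refine abBand_shift_le_sub (Δ := Δ + j * h) (by linarith) hc hb hx.1 hy.1 hh0 hκ0 hκ1 hw ?_
    have hmar : 0 < 1 - κ - wbar := by linarith
    calc h * (abBand (Δ + ↑j * h + h) a b c x y + h) ≤ h * (Etop + h) := mul_le_mul_of_nonneg_left (by linarith) hh0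
      _ ≤ 2 * (1 - κ - wbar) * Efin ^ 2 := hsmall
      _ ≤ 2 * (1 - κ - wbar) * abBand (Δ + ↑j * h + h) a b c x y ^ 2 := by
          have : Efin ^ 2 ≤ abBand (Δ + ↑j * h + h) a b c x y ^ 2 := by nlinarith [hE.le]
          nlinarith
  have := abBand_steps_le (Δ := Δ) (a := a) (b := b) (c := c) (x := x) (y := y) (κ := κ) hstep
  rw [hnh] at this
  exact this

/-! ## §2 Transfer to the Fermi energy at fixed filling (one Δ-step) -/

/-- **Shell transfer**: if every state of row `Δ` in the energy shell `(s − κδ, s]` drops by at least `κδ` under the shift (and `Δ > 0`, `a ≠ 0`, `δ ≥ 0`), then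
`abFilling(Δ; s) ≤ abFilling(Δ + δ; s − κδ)` (deep states use plain monotonicity). [folklore] -/
theorem abFilling_le_abFilling_shift_sub {Δ a b c δ κ s : ℝ} (hΔ : 0 < Δ) (ha : a ≠ 0) (hc : 0 ≤ c) (hb : 0 ≤ b) (hδ : 0 ≤ δ)
    (hshell : ∀ k : ℝ × ℝ, k ∈ Icc (0 : ℝ) π ×ˢ Icc (0 : ℝ) π → s - κ * δ < abBand Δ a b c (halfSq k.1) (halfSq k.2) →
      abBand Δ a b c (halfSq k.1) (halfSq k.2) ≤ s → abBand (Δ + δ) a b c (halfSq k.1) (halfSq k.2) + κ * δ ≤ abBand Δ a b c (halfSq k.1) (halfSq k.2)) :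
    abFilling Δ a b c s ≤ abFilling (Δ + δ) a b c (s - κ * δ) := by
  unfold abFilling
  refine div_le_div_of_nonneg_right ?_ (by positivity)
  refine ENNReal.toReal_mono (volume_abOccSet_ne_top _ _ _ _ _) (measure_mono ?_)
  intro k hk
  refine ⟨hk.1, ?_⟩
  have hk2 : abBand Δ a b c (halfSq k.1) (halfSq k.2) ≤ s := hk.2
  have hmono := abBand_shift_le_abBand (x := halfSq k.1) (y := halfSq k.2) hΔ ha hc hb (halfSq_nonneg _) (halfSq_nonneg _) hδ
  show abBand (Δ + δ) a b c (halfSq k.1) (halfSq k.2) ≤ s - κ * δ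
  by_cases hdeep : abBand Δ a b c (halfSq k.1) (halfSq k.2) ≤ s - κ * δ
  · exact hmono.trans hdeep
  · push Not at hdeep
    have := hshell k hk.1 hdeep hk2
    linarith

/-- **THE FERMI ENERGY DROPS BY AT LEAST `κδ`** (one Δ-step): `0 < ν < 1`, `Δ > 0`, `a ≠ 0`, `0 ≤ c`, `0 ≤ b`, `δ ≥ 0`, `κδ ≤ ε_F(Δ; ν)`, and the shell hypothesis of
`abFilling_le_abFilling_shift_sub` at `s = ε_F(Δ; ν)` ⇒ **`ε_F(Δ + δ; ν) + κδ ≤ ε_F(Δ; ν)`**. [folklore] -/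
theorem fermiEnergyOf_shift_le_sub_of_shell {Δ a b c δ κ ν : ℝ} (hΔ : 0 < Δ) (ha : a ≠ 0) (hc : 0 ≤ c) (hb : 0 ≤ b) (hδ : 0 ≤ δ) (hν0 : 0 < ν) (hν1 : ν < 1)
    (hroom : κ * δ ≤ fermiEnergyOf Δ a b c ν)
    (hshell : ∀ k : ℝ × ℝ, k ∈ Icc (0 : ℝ) π ×ˢ Icc (0 : ℝ) π → fermiEnergyOf Δ a b c ν - κ * δ < abBand Δ a b c (halfSq k.1) (halfSq k.2) →
      abBand Δ a b c (halfSq k.1) (halfSq k.2) ≤ fermiEnergyOf Δ a b c ν →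
      abBand (Δ + δ) a b c (halfSq k.1) (halfSq k.2) + κ * δ ≤ abBand Δ a b c (halfSq k.1) (halfSq k.2)) :
    fermiEnergyOf (Δ + δ) a b c ν + κ * δ ≤ fermiEnergyOf Δ a b c ν := by
  set s := fermiEnergyOf Δ a b c ν with hs
  have hfill : ν ≤ abFilling (Δ + δ) a b c (s - κ * δ) := by
    have h1 := abFilling_fermiEnergyOf' hΔ ha hc hb hν0 hν1
    rw [← hs] at h1
    have h2 := abFilling_le_abFilling_shift_sub hΔ ha hc hb hδ hshell
    linarith
  have hmem : s - κ * δ ∈ {ε : ℝ | 0 ≤ ε ∧ ν ≤ abFilling (Δ + δ) a b c ε} := ⟨by linarith, hfill⟩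
  have hbdd : BddBelow {ε : ℝ | 0 ≤ ε ∧ ν ≤ abFilling (Δ + δ) a b c ε} := ⟨0, fun ε hε => hε.1⟩
  have := csInf_le hbdd hmem
  unfold fermiEnergyOf
  linarith

end Summit.Ventures.CertifiedManyBodySolver.Downfold.Emery
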